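import Mathlib
import Literature.Computability.AlgebraicComplexity.Hyperdeterminant
import Literature.Computability.AlgebraicComplexity.Apolarity
import Summits.ValiantsHypothesis.ValiantsHypothesis.Theorems.DetQPDetqpThesisBorelFixedDescent
import Summits.ValiantsHypothesis.ValiantsHypothesis.Theorems.DetQPDetqpThesisHyperdetBorelFixedShape

/-!
# Crux `DetQP.DetqpThesis` (stmt-ValiantsHypothesis-0315), line `four-dimensional-determinant` —
# stub `stub_borelFixed_of_parts` (B2d): Borel-fixed witnesses for the padded four-dimensional
# determinant from the parts B2w (weights) + B2s (stabiliser) + B2t (torus limit)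

Target `pp := X₀₀^{m-n} · H_n(X_ι)` (`H_n = hyperdet (X_I)_{I : Fin 4 → Fin n}`, Cayley's first
hyperdeterminant, placed along an injective `ι` missing the padding variable `(0,0)`), group
`H(n,m,ι) ⊆ GL_{m²}`: substitutions whose used block is a Kronecker product of four upper triangular
`a_r`, padding column `X₀₀ ↦ λ X₀₀`, unused columns triangular for the order `p.1·m + p.2` plus
anything in the used/padding rows, `λ^{m-n} ∏_r ∏_i a_r(i,i) = 1` (the four clauses of the line's
stubs).  Given a generic anti-dominant cocharacter `μ` (B2w), the stabiliser identity `M · pp = pp`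
(B2s) and the torus-limit operation on `Y_pp` (B2t) as hypotheses, we prove: if some border-apolar
witness `(P, J)` inside `Ann(pp)` exists then an `H(n,m,ι)`-stable one exists.

Proof.  The UNIPOTENT class `U` of `H` (all `a_r` unit upper triangular, `λ = 1`, unit diagonal on
the unused block) gives the descent class `{M'ᵀ : M' ∈ U}` of the general descent `hdbf_descent`
(`Theorems/DetQPDetqpThesisBorelFixedDescent.lean`): every `H`-shaped `M` is `μ`-RAISING off the
diagonal (`hdbf_shape_lower`: used `X_{ιI} ↦` indices `I' ≤ I`, unused below used/padding and
decreasing along `p.1·m+p.2`), hence `Mᵀ` is block triangular for the injective `μ` and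
`det M = ∏ diag` (`hdbf_shape_det`); so `M'ᵀ` has unit diagonal, lowers `μ`, has determinant `1`,
and `((M'ᵀ)⁻¹)ᵀ = M'⁻¹` fixes `pp` (B2s).  The descent returns a `μ`-graded point of `Y_pp` stable
under all `M'ᵀ`; W4 for an invertible `M ∈ H` follows from `Mᵀ = M'ᵀ · diag(M)` with
`M' = diag(M)⁻¹ M ∈ U` and the torus stability of graded subspaces under `H`-diagonal patterns
(`hdbf_torus_stable`, genericity clause of B2w).  Adapted from the per-analogue
`Theorems/BorderApolarityBorelFixedBorderApolarity(Lowering).lean` (route BorderApolarity, item 5781).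
Folklore (Borel 1991 Thm 10.4 made explicit; Buczyńska–Buczyński 2021 Thm 31).
-/

open MvPolynomial Filter
open scoped BigOperators Topology Matrix

namespace Summit.ValiantsHypothesis.ValiantsHypothesis.Theorems.DetQPDetqpThesis.HdBorelFixed

set_option linter.dupNamespace false

open Literature.Computability.AlgebraicComplexity
open Summit.ValiantsHypothesis.ValiantsHypothesis.Theorems.BorderApolarityToricFixedPoints
open Summit.ValiantsHypothesis.ValiantsHypothesis.Theorems.BorderApolarityBorelFixedBorderApolarity

variable {n m : ℕ}

/-! ## The stub -/

/-- **Stub B2d (`stub_borelFixed_of_parts` of the line, same statement; registered here as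
`hd_borelFixed_of_parts`) — Borel-fixed witnesses from the parts: weights (B2w) + stabiliser (B2s) +
torus limit (B2t) ⇒ B2.**  Given a witness `(P, J)` for `pp := X₀₀^{m-n} H_n(X_ι)` (orbit
sequence, `IsBorderApolarLimit`, `J ⊆ Ann(pp)`), produce one whose `J` is moreover stable under
`D ↦ Mᵀ · D` for every invertible `M ∈ H(n,m,ι)` (the four conjuncts).  Proof: take `μ` from B2w;
run the general descent `hdbf_descent` over the class `{M'ᵀ : M' ∈ U}`, `U` the unipotent part of
`H` (unit diagonal by `hdbf_unip_diag`, lowering by `hdbf_shape_lower`, determinant one by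
`hdbf_shape_det`, `((M'ᵀ)⁻¹)ᵀ = M'⁻¹` fixes `pp` by B2s), with the torus limit B2t; W4 for an
invertible `M ∈ H` from `Mᵀ = M'ᵀ · diag(M)`, `M' = diag(M)⁻¹ M ∈ U`, the diagonal of `M` nowhere
zero (`hdbf_shape_det`) and `hdbf_torus_stable`. -/
theorem hd_borelFixed_of_parts (n m : ℕ) [NeZero m] (hn : 1 ≤ n) (hnm : n ≤ m)
    (ι : (Fin 4 → Fin n) → Fin m × Fin m) (hι : Function.Injective ι)
    (hℓ : ((0 : Fin m), (0 : Fin m)) ∉ Set.range ι)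
    (hW : ∃ μ : Fin m × Fin m → ℤ,
      (∀ v, 0 ≤ μ v) ∧
      Function.Injective μ ∧
      (∀ I I' : Fin 4 → Fin n, (∀ r, I' r ≤ I r) → I ≠ I' → μ (ι I) < μ (ι I')) ∧
      (∀ p : Fin m × Fin m, p ∉ Set.range ι → p ≠ (0, 0) → ∀ I : Fin 4 → Fin n, μ p < μ (ι I)) ∧
      (∀ p : Fin m × Fin m, p ∉ Set.range ι → p ≠ (0, 0) → μ p < μ (0, 0)) ∧
      (∀ p q : Fin m × Fin m, p ∉ Set.range ι → p ≠ (0, 0) → q ∉ Set.range ι → q ≠ (0, 0) →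
        (p.1 : ℕ) * m + (p.2 : ℕ) < (q.1 : ℕ) * m + (q.2 : ℕ) → μ q < μ p) ∧
      (∃ ν₀ : ℤ, ∀ d ∈ (X ((0 : Fin m), (0 : Fin m)) ^ (m - n) *
          rename ι (hyperdet fun I : Fin 4 → Fin n => (X I : MvPolynomial (Fin 4 → Fin n) ℂ))).support,
        Finsupp.weight μ d = ν₀) ∧
      (∀ e e' : Fin m × Fin m →₀ ℕ, e.degree ≤ m → e'.degree ≤ m →
        Finsupp.weight μ e = Finsupp.weight μ e' →
        ∀ d : Fin m × Fin m → ℂ, (∀ v, d v ≠ 0) →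
          (∃ t : Fin 4 → Fin n → ℂ, ∀ I : Fin 4 → Fin n, d (ι I) = ∏ r, t r (I r)) →
          ∏ v ∈ e.support, d v ^ e v = ∏ v ∈ e'.support, d v ^ e' v) ∧
      (∃ hi : ℤ, ∀ e : Fin m × Fin m →₀ ℕ, e.degree ≤ m → Finsupp.weight μ e ≤ hi))
    (hS : ∀ M : Matrix (Fin m × Fin m) (Fin m × Fin m) ℂ,
      (∃ a : Fin 4 → Matrix (Fin n) (Fin n) ℂ,
        (∀ (r : Fin 4) (i j : Fin n), j < i → a r i j = 0) ∧
        (∀ I I' : Fin 4 → Fin n, M (ι I') (ι I) = ∏ r, a r (I' r) (I r)) ∧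
        M (0, 0) (0, 0) ^ (m - n) * ∏ r, ∏ i, a r i i = 1) →
      (∀ (I : Fin 4 → Fin n) (p : Fin m × Fin m), p ∉ Set.range ι → M p (ι I) = 0) →
      (∀ p : Fin m × Fin m, p ≠ (0, 0) → M p (0, 0) = 0) →
      linSubst (Fin m × Fin m) ℂ M
          (X ((0 : Fin m), (0 : Fin m)) ^ (m - n) *
            rename ι (hyperdet fun I : Fin 4 → Fin n => (X I : MvPolynomial (Fin 4 → Fin n) ℂ))) =
        X ((0 : Fin m), (0 : Fin m)) ^ (m - n) *
          rename ι (hyperdet fun I : Fin 4 → Fin n => (X I : MvPolynomial (Fin 4 → Fin n) ℂ)))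
    (hT : ∀ (f : MvPolynomial (Fin m × Fin m) ℂ) (P : ℕ → MvPolynomial (Fin m × Fin m) ℂ),
      (∀ t, P t ∈ glOrbit (Fin m × Fin m) ℂ (detPoly (Fin m) ℂ)) →
      ∀ J : ℕ → Set (MvPolynomial (Fin m × Fin m) ℂ), IsBorderApolarLimit m P J →
      (∀ k ≤ m, ∀ D ∈ J k, apolarAction D f = 0) →
      ∀ (μ : Fin m × Fin m → ℤ) (ν₀ : ℤ), (∀ d ∈ f.support, Finsupp.weight μ d = ν₀) →
      ∃ (P' : ℕ → MvPolynomial (Fin m × Fin m) ℂ) (J' : ℕ → Set (MvPolynomial (Fin m × Fin m) ℂ)),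
        (∀ t, P' t ∈ glOrbit (Fin m × Fin m) ℂ (detPoly (Fin m) ℂ)) ∧ IsBorderApolarLimit m P' J' ∧
        (∀ k ≤ m, ∀ D ∈ J' k, apolarAction D f = 0) ∧
        (∀ k, ∀ D, D ∈ J' k ↔ D ∈ Submodule.span ℂ {D' : MvPolynomial (Fin m × Fin m) ℂ |
            ∃ E ∈ J k, ∃ ν : ℤ, D' = weightedHomogeneousComponent μ ν E ∧
              ∀ ν' : ℤ, ν' < ν → weightedHomogeneousComponent μ ν' E = 0}))
    (h : ∃ (P : ℕ → MvPolynomial (Fin m × Fin m) ℂ) (J : ℕ → Set (MvPolynomial (Fin m × Fin m) ℂ)),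
      (∀ t : ℕ, P t ∈ glOrbit (Fin m × Fin m) ℂ (detPoly (Fin m) ℂ)) ∧
      IsBorderApolarLimit m P J ∧
      (∀ k ≤ m, ∀ D ∈ J k, apolarAction D
        (X ((0 : Fin m), (0 : Fin m)) ^ (m - n) *
          rename ι (hyperdet fun I : Fin 4 → Fin n => (X I : MvPolynomial (Fin 4 → Fin n) ℂ))) = 0)) :
    ∃ (P : ℕ → MvPolynomial (Fin m × Fin m) ℂ) (J : ℕ → Set (MvPolynomial (Fin m × Fin m) ℂ)),
      (∀ t : ℕ, P t ∈ glOrbit (Fin m × Fin m) ℂ (detPoly (Fin m) ℂ)) ∧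
      IsBorderApolarLimit m P J ∧
      (∀ A : Matrix.GeneralLinearGroup (Fin m × Fin m) ℂ,
        let M : Matrix (Fin m × Fin m) (Fin m × Fin m) ℂ := A;
        (∃ a : Fin 4 → Matrix (Fin n) (Fin n) ℂ,
            (∀ (r : Fin 4) (i j : Fin n), j < i → a r i j = 0) ∧
            (∀ I I' : Fin 4 → Fin n, M (ι I') (ι I) = ∏ r, a r (I' r) (I r)) ∧
            M (0, 0) (0, 0) ^ (m - n) * ∏ r, ∏ i, a r i i = 1) →
        (∀ (I : Fin 4 → Fin n) (p : Fin m × Fin m), p ∉ Set.range ι → M p (ι I) = 0) →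
        (∀ p : Fin m × Fin m, p ≠ (0, 0) → M p (0, 0) = 0) →
        (∀ p q : Fin m × Fin m, p ∉ Set.range ι → p ≠ (0, 0) → q ∉ Set.range ι → q ≠ (0, 0) →
            (p.1 : ℕ) * m + (p.2 : ℕ) < (q.1 : ℕ) * m + (q.2 : ℕ) → M q p = 0) →
        ∀ k ≤ m, ∀ D ∈ J k, linSubst (Fin m × Fin m) ℂ Mᵀ D ∈ J k) ∧
      (∀ k ≤ m, ∀ D ∈ J k, apolarAction D
        (X ((0 : Fin m), (0 : Fin m)) ^ (m - n) *
          rename ι (hyperdet fun I : Fin 4 → Fin n => (X I : MvPolynomial (Fin 4 → Fin n) ℂ))) = 0) := by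
  classical
  -- `1 ≤ n ≤ m`, the injectivity of `ι` and `(0,0) ∉ range ι` are part of the registered signature but
  -- are not needed by the proof
  have _sig : 1 ≤ n ∧ n ≤ m ∧ Function.Injective ι ∧ ((0 : Fin m), (0 : Fin m)) ∉ Set.range ι :=
    ⟨hn, hnm, hι, hℓ⟩
  -- notation
  set f : MvPolynomial (Fin m × Fin m) ℂ := X ((0 : Fin m), (0 : Fin m)) ^ (m - n) *
    rename ι (hyperdet fun I : Fin 4 → Fin n => (X I : MvPolynomial (Fin 4 → Fin n) ℂ)) with hf
  obtain ⟨μ, hμ0, hμinj, h2i, h2a, h2b, h2c, ⟨ν₀, hν₀⟩, hμ4, hi, hμhi⟩ := hW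
  obtain ⟨P₀, J₀, hP₀, hJ₀, hJ₀f⟩ := h
  -- the unipotent class `U` (as a predicate) and the descent class `{M'ᵀ : M' ∈ U}`
  set IsU : Matrix (Fin m × Fin m) (Fin m × Fin m) ℂ → Prop := fun M' =>
    (∃ a : Fin 4 → Matrix (Fin n) (Fin n) ℂ,
      (∀ (r : Fin 4) (i j : Fin n), j < i → a r i j = 0) ∧ (∀ (r : Fin 4) (i : Fin n), a r i i = 1) ∧
      (∀ I I' : Fin 4 → Fin n, M' (ι I') (ι I) = ∏ r, a r (I' r) (I r))) ∧
    (∀ (I : Fin 4 → Fin n) (p : Fin m × Fin m), p ∉ Set.range ι → M' p (ι I) = 0) ∧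
    (∀ p : Fin m × Fin m, p ≠ (0, 0) → M' p (0, 0) = 0) ∧
    (∀ p q : Fin m × Fin m, p ∉ Set.range ι → p ≠ (0, 0) → q ∉ Set.range ι → q ≠ (0, 0) →
      (p.1 : ℕ) * m + (p.2 : ℕ) < (q.1 : ℕ) * m + (q.2 : ℕ) → M' q p = 0) ∧
    M' (0, 0) (0, 0) = 1 ∧
    (∀ p : Fin m × Fin m, p ∉ Set.range ι → p ≠ (0, 0) → M' p p = 1) with hIsU
  set IsV : Matrix (Fin m × Fin m) (Fin m × Fin m) ℂ → Prop := fun V => IsU Vᵀ with hIsV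
  -- properties of `U`
  have hUshape : ∀ M', IsU M' → ∃ a : Fin 4 → Matrix (Fin n) (Fin n) ℂ,
      (∀ (r : Fin 4) (i j : Fin n), j < i → a r i j = 0) ∧
      (∀ I I' : Fin 4 → Fin n, M' (ι I') (ι I) = ∏ r, a r (I' r) (I r)) := by
    rintro M' ⟨⟨a, htri, -, hent⟩, -⟩
    exact ⟨a, htri, hent⟩
  have hUdiag : ∀ M', IsU M' → ∀ a, M' a a = 1 := by
    rintro M' ⟨h1, -, -, -, h5, h6⟩
    exact hdbf_unip_diag ι M' h1 h5 h6
  have hUlow : ∀ M', IsU M' → ∀ a b, a ≠ b → M' b a ≠ 0 → μ a < μ b := by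
    intro M' hU
    exact hdbf_shape_lower ι μ h2i h2a h2b h2c M' (hUshape M' hU) hU.2.1 hU.2.2.1 hU.2.2.2.1
  have hUdet : ∀ M', IsU M' → M'.det = 1 := by
    intro M' hU
    rw [hdbf_shape_det ι μ hμinj h2i h2a h2b h2c M' (hUshape M' hU) hU.2.1 hU.2.2.1 hU.2.2.2.1]
    exact Finset.prod_eq_one fun a _ => hUdiag M' hU a
  have hUfix : ∀ M', IsU M' → linSubst (Fin m × Fin m) ℂ M' f = f := by
    rintro M' ⟨⟨a, htri, hone, hent⟩, h2, h3, -, h5, -⟩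
    refine hS M' ⟨a, htri, hent, ?_⟩ h2 h3
    rw [h5, one_pow, one_mul]
    exact Finset.prod_eq_one fun r _ => Finset.prod_eq_one fun i _ => hone r i
  -- the hypotheses of the general descent for the class `IsV`
  have hV1 : ∀ V, IsV V → ∀ a, V a a = 1 := fun V hV a => hUdiag Vᵀ hV a
  have hVμ : ∀ V, IsV V → ∀ a b, a ≠ b → V a b ≠ 0 → μ a < μ b :=
    fun V hV a b hab hne => hUlow Vᵀ hV a b hab hne
  have hVdet : ∀ V, IsV V → IsUnit V.det := by
    intro V hV
    rw [← Matrix.det_transpose, hUdet Vᵀ hV]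
    exact isUnit_one
  have hVf : ∀ V, IsV V → linSubst (Fin m × Fin m) ℂ (V⁻¹)ᵀ f = f := by
    intro V hV
    have hVu : IsUnit Vᵀ.det := by rw [hUdet Vᵀ hV]; exact isUnit_one
    have hinv : (V⁻¹)ᵀ = (Vᵀ)⁻¹ := Matrix.transpose_nonsing_inv V
    rw [hinv]
    conv_lhs => rw [← hUfix Vᵀ hV]
    exact bfba_linSubst_inv_linSubst Vᵀ hVu f
  have hTL : ∀ (P : ℕ → MvPolynomial (Fin m × Fin m) ℂ) (J : ℕ → Set (MvPolynomial (Fin m × Fin m) ℂ)),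
      (∀ t, P t ∈ glOrbit (Fin m × Fin m) ℂ (detPoly (Fin m) ℂ)) → IsBorderApolarLimit m P J →
      (∀ k ≤ m, ∀ D ∈ J k, apolarAction D f = 0) →
      ∃ (P' : ℕ → MvPolynomial (Fin m × Fin m) ℂ) (J' : ℕ → Set (MvPolynomial (Fin m × Fin m) ℂ)),
        (∀ t, P' t ∈ glOrbit (Fin m × Fin m) ℂ (detPoly (Fin m) ℂ)) ∧ IsBorderApolarLimit m P' J' ∧
        (∀ k ≤ m, ∀ D ∈ J' k, apolarAction D f = 0) ∧
        (∀ k, ∀ D, D ∈ J' k ↔ D ∈ Submodule.span ℂ {D' : MvPolynomial (Fin m × Fin m) ℂ |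
            ∃ E ∈ J k, ∃ ν : ℤ, D' = weightedHomogeneousComponent μ ν E ∧
              ∀ ν' : ℤ, ν' < ν → weightedHomogeneousComponent μ ν' E = 0}) :=
    fun P J hP hJ hJf => hT f P hP J hJ hJf μ ν₀ hν₀
  -- torus limit, then descent
  obtain ⟨P₁, J₁, hP₁, hJ₁, hJ₁f, hJ₁in⟩ := hTL P₀ J₀ hP₀ hJ₀ hJ₀f
  have hgr₁ : ∀ k ≤ m, ∀ D ∈ J₁ k, ∀ ν : ℤ, weightedHomogeneousComponent μ ν D ∈ J₁ k :=
    fun k _ D hD ν => (hJ₁in k _).2 (bfba_initSpan_graded_set μ _ D ((hJ₁in k D).1 hD) ν)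
  obtain ⟨P, J, hP, hJ, hJf, hgr, hU⟩ :=
    hdbf_descent f μ hμ0 hi hμhi IsV hV1 hVμ hVdet hVf hTL _ P₁ J₁ hP₁ hJ₁ hJ₁f hgr₁ le_rfl
  have hJsub : ∀ k ≤ m, ∃ Lk : Submodule ℂ (MvPolynomial (Fin m × Fin m) ℂ),
      (Lk : Set (MvPolynomial (Fin m × Fin m) ℂ)) = J k ∧ Lk ≤ homogeneousSubmodule (Fin m × Fin m) ℂ k :=
    fun k hk => by
      obtain ⟨Lk, h1, h2, -⟩ := bfba_exists_submodule P hP J hJ k hk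
      exact ⟨Lk, h1, h2⟩
  refine ⟨P, J, hP, hJ, ?_, hJf⟩
  -- W4
  intro A M ha hb hc hd k hk D hD
  have hMunit : IsUnit M.det := (Matrix.isUnit_iff_isUnit_det _).1 (Units.isUnit A)
  obtain ⟨a, htri, hent, hnorm⟩ := ha
  have hdetM := hdbf_shape_det ι μ hμinj h2i h2a h2b h2c M ⟨a, htri, hent⟩ hb hc hd
  have hdiag : ∀ v, M v v ≠ 0 := by
    have h0 := hMunit.ne_zero
    rw [hdetM, Finset.prod_ne_zero_iff] at h0
    exact fun v => h0 v (Finset.mem_univ v)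
  have hadiag : ∀ (r : Fin 4) (i : Fin n), a r i i ≠ 0 := by
    intro r i
    have h1 := hdiag (ι fun _ => i)
    rw [hent, Finset.prod_ne_zero_iff] at h1
    exact h1 r (Finset.mem_univ r)
  -- `M' = diag(M)⁻¹ M ∈ U`
  set M' : Matrix (Fin m × Fin m) (Fin m × Fin m) ℂ := fun i j => M i j / M i i with hM'
  have hM'U : IsU M' := by
    refine ⟨⟨fun r i j => a r i j / a r i i, fun r i j hji => ?_, fun r i => div_self (hadiag r i),
      fun I I' => ?_⟩, fun I p hp => ?_, fun p hp => ?_, fun p q hp hp0 hq hq0 hlt => ?_, div_self (hdiag _),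
      fun p _ _ => div_self (hdiag p)⟩
    · show a r i j / a r i i = 0
      rw [htri r i j hji, zero_div]
    · simp only [hM']
      rw [hent I I', hent I' I', ← Finset.prod_div_distrib]
    · simp only [hM']
      rw [hb I p hp, zero_div]
    · simp only [hM']
      rw [hc p hp, zero_div]
    · simp only [hM']
      rw [hd p q hp hp0 hq hq0 hlt, zero_div]
  -- `Mᵀ = M'ᵀ · diag(M)`
  have hMt : Mᵀ = M'ᵀ * Matrix.diagonal fun v => M v v := by
    ext i j
    rw [Matrix.mul_diagonal, Matrix.transpose_apply, Matrix.transpose_apply]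
    simp only [hM']
    rw [div_mul_cancel₀ _ (hdiag j)]
  rw [hMt, linSubst_mul, AlgHom.comp_apply]
  have hIsVM : IsV M'ᵀ := by
    show IsU M'ᵀᵀ
    rw [Matrix.transpose_transpose]
    exact hM'U
  refine hU M'ᵀ hIsVM k hk _ ?_
  obtain ⟨Lk, hLk, hLkle⟩ := hJsub k hk
  have hmem : ∀ E, E ∈ Lk ↔ E ∈ J k := fun E => by rw [← SetLike.mem_coe, hLk]
  rw [← hmem]
  exact hdbf_torus_stable ι μ hμ4 k hk Lk hLkle (fun E hE ν => (hmem _).2 (hgr k hk E ((hmem E).1 hE) ν))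
    (fun v => M v v) hdiag ⟨fun r i => a r i i, fun I => hent I I⟩ D ((hmem D).2 hD)

end Summit.ValiantsHypothesis.ValiantsHypothesis.Theorems.DetQPDetqpThesis.HdBorelFixed
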